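import Summits.QuantumFields.YangMills.Theorems.StiffComplementSchurSlowProjection
import Summits.QuantumFields.YangMills.Theorems.FemtoTransferGapReduction
import Summits.QuantumFields.YangMills.Theorems.FemtoTransferGapSlabRayleigh
import Summits.QuantumFields.YangMills.Theorems.LuscherReductionOneSiteLevelsVariational
import Summits.QuantumFields.YangMills.Theorems.FemtoTransferGapPositivity
import HarnessLib

/-!
# Preliminaries for `StiffComplementSchur.SchurEnclosureP` (item stmt-QuantumFields-23303)

Route `StiffComplementSchur` (D-0145 LINE g16-A of seat ym-idea-4, rev 1).  This module holds the two ingredients of the Schur enclosure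
that are not already tree doors:

* §2 `levelValue_le_of_pen_capture` — the UPPER Rayleigh bound for one level: with the first `k` frame lifts as Courant–Fischer constraints
  (`levelValue_le_of_forall_rayleigh_le`), every admissible physical `ψ` splits EXACTLY as `ψ = s_h + g` by the landed slow projection
  (`exists_slowProjection`, `g ⊥` the whole Ω-dressed flowed-Polyakov family), and PEN + CAPTURE give
  `⟨ψ,Kψ⟩ ≤ (mcap + Cpen)‖s_h‖² + θp‖g‖² ≤ a‖ψ‖²`;
* §3 isolated real-arithmetic lemmas (window smallness, large one-site coupling, «stiff threshold below the slow level», the final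
  product-form bookkeeping with constant `2A + 3|C₁|`).

HONEST FRAMING: spectral bookkeeping on rung-class leaves; the cruxes and the leaf `RunningReduction` remain OPEN; nothing here is infinite
volume, the continuum or the Clay problem; the YM mass gap is NOT proved.  No `sorry`, no new axiom, no new definition.
References: [cite: ReedSimonIV1978, Thm. XIII.1]; [cite: GustafsonSigal2003, §11.1]; [cite: Luscher1983, §3].
-/

set_option autoImplicit false

noncomputable section

open MeasureTheory Filter Topology Real
open Literature.MathematicalPhysics.QuantumFieldTheory (GaugeConfig Site gaugeTransform wilsonFlow measurable_wilsonFlow)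
open Literature.MathematicalPhysics.QuantumLattice (secondCountableTopology_su2)

namespace Summit.QuantumFields.YangMills.Theorems.StiffComplementSchur

open Summit.QuantumFields.YangMills.Theorems.FemtoTransferGap

variable {L : ℕ} [NeZero L]

/-! ## §1 Small facts -/

omit [NeZero L] in
/-- Products of physical test functions are physical. [folklore] -/
theorem isPhys_mul_fun {ψ φ : GaugeConfig 3 L SU2 → ℝ} (hψ : IsPhys ψ) (hφ : IsPhys φ) :
    IsPhys (fun U => ψ U * φ U) where
  measurable := hψ.measurable.mul hφ.measurable
  bounded := by
    obtain ⟨C, hC⟩ := hψ.bounded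
    obtain ⟨D, hD⟩ := hφ.bounded
    exact ⟨C * D, fun U => by
      rw [abs_mul]
      exact mul_le_mul (hC U) (hD U) (abs_nonneg _) ((abs_nonneg _).trans (hC U))⟩
  gaugeInv := fun g U => by simp only [hψ.gaugeInv g U, hφ.gaugeInv g U]
  zeroFlux := fun k z hz U => by simp only [hψ.zeroFlux k z hz U, hφ.zeroFlux k z hz U]

/-- The slow lift `s_f = (flowLiftAt x₀ t f)·Ω` of a physical one-site `f` is physical. [cite: Luscher2010, §2.1] -/
theorem isPhys_slow {Ω : GaugeConfig 3 L SU2 → ℝ} (hΩ : IsPhys Ω) (x₀ : Site 3 L) (t : ℝ)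
    {f : GaugeConfig 3 1 SU2 → ℝ} (hf : IsPhys f) : IsPhys (fun U => flowLiftAt x₀ t f U * Ω U) :=
  isPhys_mul_fun (isPhys_flowLiftAt x₀ t hf) hΩ

/-- In the window the effective one-site coupling grows at least linearly in `L`: `L/(4 lam³) ≤ B(β, L)`. [folklore] -/
theorem oneSiteCoupling_ge_linear {lam β : ℝ} (hlam : 0 < lam) (h : InFemtoWindow lam β L) :
    (L : ℝ) / (4 * lam ^ 3) ≤ oneSiteCoupling β L := by
  have hl : 0 < luscherLambda β L := luscherLambda_pos_of_window hlam h
  have hL1 : (1 : ℝ) ≤ L := by exact_mod_cast NeZero.one_le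
  have hle : luscherLambda β L ≤ 2 * lam := h.2.2
  unfold oneSiteCoupling
  rw [div_le_div_iff₀ (by positivity) (by positivity)]
  have h1 : luscherLambda β L ^ 3 ≤ (2 * lam) ^ 3 := by gcongr
  have h2 : (L : ℝ) ≤ (L : ℝ) ^ 3 := by
    calc (L : ℝ) = L * 1 * 1 := by ring
      _ ≤ L * L * L := by gcongr
      _ = (L : ℝ) ^ 3 := by ring
  nlinarith [h1, h2, pow_pos hlam 3, pow_pos hl 3]

/-! ## §2 The upper Rayleigh bound from PEN + CAPTURE + slow projection -/

/-- **Upper half, one level.**  If the stiff-penalty clause PEN holds at `(x₀, t)` for the uniformly positive physical `Ω` with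
coefficients `θp` (stiff) and `Cpen` (leak), and the slow family carries a physical frame `fs : Fin (k+1)` whose CAPTURE at the last index
has constant `mcap`, then `λ_k ≤ a` for any `a ≥ max (θp, mcap + Cpen)`, `a ≥ 0`: constraints = the first `k` frame lifts; each admissible
`ψ` splits as `s_h + g` (`exists_slowProjection`), `⟨ψ,Kψ⟩ ≤ (mcap + Cpen)‖s_h‖² + θp‖g‖² ≤ a‖ψ‖²`. [cite: ReedSimonIV1978, Thm. XIII.1] -/
theorem levelValue_le_of_pen_capture {β : ℝ} {Ω : GaugeConfig 3 L SU2 → ℝ} (hΩ : IsPhys Ω) {cΩ : ℝ} (hcΩ : 0 < cΩ)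
    (hΩge : ∀ U, cΩ ≤ Ω U) (x₀ : Site 3 L) (t : ℝ) {k : ℕ} (fs : Fin (k + 1) → (GaugeConfig 3 1 SU2 → ℝ))
    (hfs : ∀ i, IsPhys (fs i)) {θp Cpen mcap a : ℝ}
    (hPEN : ∀ f : GaugeConfig 3 1 SU2 → ℝ, IsPhys f → ∀ g : GaugeConfig 3 L SU2 → ℝ, IsPhys g →
      (∀ f'' : GaugeConfig 3 1 SU2 → ℝ, IsPhys f'' → l2 g (fun U => flowLiftAt x₀ t f'' U * Ω U) = 0) →
      2 * qform su2Rep β g (fun U => flowLiftAt x₀ t f U * Ω U) ≤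
        (θp * l2 g g - qform su2Rep β g g) +
          Cpen * l2 (fun U => flowLiftAt x₀ t f U * Ω U) (fun U => flowLiftAt x₀ t f U * Ω U))
    (hCAP : ∀ f : GaugeConfig 3 1 SU2 → ℝ, IsPhys f →
      (∀ i : Fin (k + 1), i < Fin.last k →
        l2 (fun U => flowLiftAt x₀ t f U * Ω U) (fun U => flowLiftAt x₀ t (fs i) U * Ω U) = 0) →
      qform su2Rep β (fun U => flowLiftAt x₀ t f U * Ω U) (fun U => flowLiftAt x₀ t f U * Ω U) ≤
        mcap * l2 (fun U => flowLiftAt x₀ t f U * Ω U) (fun U => flowLiftAt x₀ t f U * Ω U))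
    (ha0 : 0 ≤ a) (hθa : θp ≤ a) (hma : mcap + Cpen ≤ a) :
    levelValue su2Rep L β k ≤ a := by
  refine levelValue_le_of_forall_rayleigh_le su2Rep β ha0
    (fun i : Fin k => fun U => flowLiftAt x₀ t (fs (Fin.castSucc i)) U * Ω U)
    (fun i => isPhys_slow hΩ x₀ t (hfs _)) ?_
  intro ψ hψ horth _hpos
  obtain ⟨h, hh, hproj⟩ := exists_slowProjection hΩ hcΩ hΩge x₀ t hψ
  set v : GaugeConfig 3 L SU2 → ℝ := fun U => flowLiftAt x₀ t h U * Ω U with hv_def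
  have hv : IsPhys v := isPhys_slow hΩ x₀ t hh
  set g : GaugeConfig 3 L SU2 → ℝ := ψ + (-1 : ℝ) • v with hg_def
  have hg : IsPhys g := hψ.add (hv.smul (-1))
  -- `g ⊥` the whole slow family
  have horthV : ∀ f'' : GaugeConfig 3 1 SU2 → ℝ, IsPhys f'' →
      l2 g (fun U => flowLiftAt x₀ t f'' U * Ω U) = 0 := by
    intro f'' hf''
    rw [hg_def, l2_add_left hψ (hv.smul _) (isPhys_slow hΩ x₀ t hf''), l2_smul_left, hproj f'' hf'']
    ring
  -- `v ⊥` the first `k` frame lifts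
  have hvorth : ∀ i : Fin (k + 1), i < Fin.last k →
      l2 v (fun U => flowLiftAt x₀ t (fs i) U * Ω U) = 0 := by
    intro i hi
    obtain ⟨i', rfl⟩ := Fin.exists_castSucc_eq.mpr (ne_of_lt hi)
    rw [hv_def, ← hproj _ (hfs _)]
    exact horth i'
  have hPENv := hPEN h hh g hg horthV
  have hCAPv := hCAP h hh hvorth
  have hgv : l2 g v = 0 := horthV h hh
  -- expansions
  have hψvg : ψ = v + g := by
    funext U
    simp only [hg_def, Pi.add_apply, Pi.smul_apply, smul_eq_mul]
    ring
  have hq : qform su2Rep β (v + g) (v + g) = qform su2Rep β v v + 2 * qform su2Rep β g v + qform su2Rep β g g := by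
    rw [qform_add_left β hv hg (hv.add hg), qform_su2Rep_comm β hv (hv.add hg), qform_su2Rep_comm β hg (hv.add hg),
      qform_add_left β hv hg hv, qform_add_left β hv hg hg, qform_su2Rep_comm β hv hg]
    ring
  have hl : l2 (v + g) (v + g) = l2 v v + l2 g g := by
    rw [l2_add_left hv hg (hv.add hg), l2_comm v (v + g), l2_comm g (v + g), l2_add_left hv hg hv, l2_add_left hv hg hg,
      l2_comm v g, hgv]
    ring
  rw [hψvg, hq, hl]
  have hvv : 0 ≤ l2 v v := l2_self_nonneg v
  have hgg : 0 ≤ l2 g g := l2_self_nonneg g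
  have h1 : (mcap + Cpen) * l2 v v ≤ a * l2 v v := mul_le_mul_of_nonneg_right hma hvv
  have h2 : θp * l2 g g ≤ a * l2 g g := mul_le_mul_of_nonneg_right hθa hgg
  nlinarith [hPENv, hCAPv, h1, h2]


/-! ## §3 Real-arithmetic bookkeeping (isolated, small contexts) -/

omit [NeZero L] in
/-- Window smallness: with `W = 2A + D + 2C_o + 1` and `lam ≤ min(c,1)/(8W)`, `Λ ≤ 2 lam`, `L ≥ 1`:
`DΛ/L + C_o(Λ/L)² ≤ 1` and `AΛ² + DΛ + C_oΛ²/L ≤ c/2`. [folklore] -/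
theorem window_smallness {A D Co c lam Λ Lr : ℝ} (hA : 0 ≤ A) (hD : 0 ≤ D) (hCo : 0 ≤ Co) (hc : 0 < c)
    (hlamW : lam ≤ min c 1 / (8 * (2 * A + D + 2 * Co + 1))) (hΛ0 : 0 < Λ) (hΛ : Λ ≤ 2 * lam) (hL : 1 ≤ Lr) :
    D * (Λ / Lr) + Co * (Λ / Lr) ^ 2 ≤ 1 ∧ A * Λ ^ 2 + D * Λ + Co * Λ ^ 2 / Lr ≤ c / 2 := by
  have hW0 : 0 < 2 * A + D + 2 * Co + 1 := by positivity
  have hWlam : 8 * (2 * A + D + 2 * Co + 1) * lam ≤ min c 1 := by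
    have := (le_div_iff₀ (by positivity : (0 : ℝ) < 8 * (2 * A + D + 2 * Co + 1))).1 hlamW
    linarith
  have hmin_c : min c 1 ≤ c := min_le_left _ _
  have hmin_1 : min c 1 ≤ 1 := min_le_right _ _
  have hlam1 : lam ≤ 1 := by nlinarith
  have hΛ2 : Λ ≤ 2 := by linarith
  have hL0 : 0 < Lr := by linarith
  have hq0 : 0 ≤ Λ / Lr := div_nonneg hΛ0.le hL0.le
  have hq1 : Λ / Lr ≤ Λ := div_le_self hΛ0.le hL
  have hΛsq : Λ ^ 2 ≤ 2 * Λ := by nlinarith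
  have hsq2 : (Λ / Lr) ^ 2 ≤ 2 * Λ := by nlinarith
  have hdiv : Co * Λ ^ 2 / Lr ≤ Co * Λ ^ 2 := div_le_self (by positivity) hL
  have hW1 : D + 2 * Co ≤ 2 * A + D + 2 * Co + 1 := by linarith
  have hW2 : 2 * A + D + 2 * Co ≤ 2 * A + D + 2 * Co + 1 := by linarith
  constructor
  · calc D * (Λ / Lr) + Co * (Λ / Lr) ^ 2 ≤ D * Λ + Co * (2 * Λ) :=
          add_le_add (mul_le_mul_of_nonneg_left hq1 hD) (mul_le_mul_of_nonneg_left hsq2 hCo)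
      _ = (D + 2 * Co) * Λ := by ring
      _ ≤ (2 * A + D + 2 * Co + 1) * (2 * lam) := mul_le_mul hW1 hΛ hΛ0.le hW0.le
      _ ≤ 1 := by nlinarith
  · calc A * Λ ^ 2 + D * Λ + Co * Λ ^ 2 / Lr ≤ A * (2 * Λ) + D * Λ + Co * (2 * Λ) :=
          add_le_add (add_le_add (mul_le_mul_of_nonneg_left hΛsq hA) le_rfl)
            (hdiv.trans (mul_le_mul_of_nonneg_left hΛsq hCo))
      _ = (2 * A + D + 2 * Co) * Λ := by ring
      _ ≤ (2 * A + D + 2 * Co + 1) * (2 * lam) := mul_le_mul hW2 hΛ hΛ0.le hW0.le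
      _ ≤ c / 2 := by nlinarith

omit [NeZero L] in
/-- Large one-site coupling: `L/(4lam³) ≤ B` and `⌈4 lam³ B₀⌉ + 1 ≤ L` give `B₀ ≤ B`. [folklore] -/
theorem B0_le_of_linear {lam B B₀ Lr : ℝ} (hlam : 0 < lam) (h1 : Lr / (4 * lam ^ 3) ≤ B)
    (h2 : (⌈4 * lam ^ 3 * B₀⌉₊ : ℝ) + 1 ≤ Lr) : B₀ ≤ B := by
  have h3 : 4 * lam ^ 3 * B₀ ≤ ⌈4 * lam ^ 3 * B₀⌉₊ := Nat.le_ceil _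
  have h4 : 0 < 4 * lam ^ 3 := by positivity
  rw [div_le_iff₀ h4] at h1
  have h5 : B₀ * (4 * lam ^ 3) < B * (4 * lam ^ 3) := by nlinarith
  exact (lt_of_mul_lt_mul_right h5 h4.le).le

omit [NeZero L] in
/-- **The stiff threshold lies below the slow level** (product form): from `λ₀ ≤ e_K m₀`, `μ_k m₀ ≤ e_K m_k μ₀`, `e_K ≤ e^{AX}`,
`ε μ₀ ≤ μ_k` with `e^{−E₁} ≤ ε`, `μ₀ > 0` and `AX + E₁ ≤ c/(2L)`: `e^{−c/(2L)} λ₀ ≤ e^{AX} m_k`. [folklore] -/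
theorem stiff_below_slow {T m0 mk μ0 μk eK ε A X E₁ c Lr : ℝ} (hT : 0 ≤ T) (hm0 : 0 ≤ m0) (hmk : 0 ≤ mk)
    (hμ0 : 0 < μ0) (hcap0 : T ≤ eK * m0) (hrat : μk * m0 ≤ eK * (mk * μ0)) (heK : eK ≤ Real.exp (A * X))
    (hε : Real.exp (-E₁) ≤ ε) (hos : ε * μ0 ≤ μk) (hexp : A * X + E₁ ≤ c / (2 * Lr)) :
    Real.exp (-c / (2 * Lr)) * T ≤ Real.exp (A * X) * mk := by
  have hε0 : 0 ≤ ε := (Real.exp_pos _).le.trans hε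
  -- `ε m₀ ≤ e^{AX} m_k`
  have h1 : ε * m0 ≤ Real.exp (A * X) * mk := by
    have h1a : ε * m0 * μ0 ≤ μk * m0 := by
      have := mul_le_mul_of_nonneg_right hos hm0
      nlinarith
    have h1b : μk * m0 ≤ Real.exp (A * X) * mk * μ0 :=
      hrat.trans (by nlinarith [mul_nonneg hmk hμ0.le])
    exact le_of_mul_le_mul_right (h1a.trans h1b) hμ0
  -- `e^{−AX} λ₀ ≤ m₀`
  have h2 : Real.exp (-(A * X)) * T ≤ m0 := by
    have h2a : T ≤ Real.exp (A * X) * m0 := hcap0.trans (mul_le_mul_of_nonneg_right heK hm0)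
    have h2b := mul_le_mul_of_nonneg_left h2a (Real.exp_pos (-(A * X))).le
    rw [← mul_assoc, ← Real.exp_add, neg_add_cancel, Real.exp_zero, one_mul] at h2b
    exact h2b
  -- `e^{−c/(2L)} ≤ ε e^{−AX}`
  have h3 : Real.exp (-c / (2 * Lr)) ≤ ε * Real.exp (-(A * X)) := by
    have h3a : Real.exp (-c / (2 * Lr)) ≤ Real.exp (-E₁) * Real.exp (-(A * X)) := by
      rw [← Real.exp_add, Real.exp_le_exp]
      have : -c / (2 * Lr) = -(c / (2 * Lr)) := by ring
      rw [this]
      linarith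
    exact h3a.trans (mul_le_mul_of_nonneg_right hε (Real.exp_pos _).le)
  calc Real.exp (-c / (2 * Lr)) * T ≤ ε * Real.exp (-(A * X)) * T := mul_le_mul_of_nonneg_right h3 hT
    _ = ε * (Real.exp (-(A * X)) * T) := by ring
    _ ≤ ε * m0 := mul_le_mul_of_nonneg_left h2 hε0
    _ ≤ Real.exp (A * X) * mk := h1

omit [NeZero L] in
/-- `e^{2Ax} + 3|C₁|x ≤ e^{(2A + 3|C₁|)x}` for `x ≥ 0`, `A ≥ 0`. [folklore] -/
theorem exp_add_linear_le {A C₁ x : ℝ} (hA : 0 ≤ A) (hx : 0 ≤ x) :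
    Real.exp (A * x) * Real.exp (A * x) + 3 * |C₁| * x ≤ Real.exp ((2 * A + 3 * |C₁|) * x) := by
  have h1 : 1 ≤ Real.exp (A * x) * Real.exp (A * x) := by
    have := Real.one_le_exp (show 0 ≤ A * x by positivity)
    nlinarith
  have h2 : 3 * |C₁| * x + 1 ≤ Real.exp (3 * |C₁| * x) := Real.add_one_le_exp _
  have h3 : 0 ≤ 3 * |C₁| * x := by positivity
  have h4 : 0 ≤ Real.exp (A * x) * Real.exp (A * x) := by positivity
  calc Real.exp (A * x) * Real.exp (A * x) + 3 * |C₁| * x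
      ≤ Real.exp (A * x) * Real.exp (A * x) + Real.exp (A * x) * Real.exp (A * x) * (3 * |C₁| * x) := by nlinarith
    _ = Real.exp (A * x) * Real.exp (A * x) * (3 * |C₁| * x + 1) := by ring
    _ ≤ Real.exp (A * x) * Real.exp (A * x) * Real.exp (3 * |C₁| * x) := mul_le_mul_of_nonneg_left h2 h4
    _ = Real.exp ((2 * A + 3 * |C₁|) * x) := by rw [← Real.exp_add, ← Real.exp_add]; ring_nf

omit [NeZero L] in
/-- **The final product-form bookkeeping**: from Ritz, `m₀ ≤ λ₀ ≤ e_K m₀`, the two RATIO bounds, `μ₀ ≤ 3μ_k`, `0 ≤ e_K ≤ e^{AX}` and the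
upper Rayleigh bound `λ_k ≤ e^{AX} m_k + |C₁| X λ₀`: both halves of `RunningReduction` with constant `2A + 3|C₁|`. [folklore] -/
theorem enclosure_arith {T lk μ0 μk m0 mk eK A C₁ X : ℝ} (hT : 0 ≤ T) (hμ0 : 0 ≤ μ0) (hμk : 0 ≤ μk)
    (hm0 : 0 ≤ m0) (hmk : 0 ≤ mk) (hX : 0 ≤ X) (hA : 0 ≤ A) (heK0 : 0 ≤ eK)
    (hritz : mk ≤ lk) (hm0le : m0 ≤ T) (hcap0 : T ≤ eK * m0)
    (hrat1 : mk * μ0 ≤ eK * (μk * m0)) (hrat2 : μk * m0 ≤ eK * (mk * μ0)) (hmu : μ0 ≤ 3 * μk)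
    (heK : eK ≤ Real.exp (A * X)) (hupper : lk ≤ Real.exp (A * X) * mk + |C₁| * X * T) :
    lk * μ0 ≤ Real.exp ((2 * A + 3 * |C₁|) * X) * (μk * T) ∧
      μk * T ≤ Real.exp ((2 * A + 3 * |C₁|) * X) * (lk * μ0) := by
  have heA0 : 0 ≤ Real.exp (A * X) := (Real.exp_pos _).le
  have hlk : 0 ≤ lk := hmk.trans hritz
  have hEE : Real.exp (A * X) * Real.exp (A * X) ≤ Real.exp ((2 * A + 3 * |C₁|) * X) := by
    have h := exp_add_linear_le (C₁ := C₁) hA hX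
    nlinarith [show 0 ≤ 3 * |C₁| * X by positivity]
  constructor
  · -- upper half
    have h1 : lk * μ0 ≤ Real.exp (A * X) * (mk * μ0) + |C₁| * X * T * μ0 := by
      have := mul_le_mul_of_nonneg_right hupper hμ0
      nlinarith
    have h2 : mk * μ0 ≤ Real.exp (A * X) * (μk * T) := by
      calc mk * μ0 ≤ eK * (μk * m0) := hrat1
        _ ≤ eK * (μk * T) := mul_le_mul_of_nonneg_left (mul_le_mul_of_nonneg_left hm0le hμk) heK0
        _ ≤ Real.exp (A * X) * (μk * T) := mul_le_mul_of_nonneg_right heK (mul_nonneg hμk hT)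
    have h3 : |C₁| * X * T * μ0 ≤ 3 * |C₁| * X * (μk * T) := by
      have := mul_le_mul_of_nonneg_left hmu (show 0 ≤ |C₁| * X * T by positivity)
      nlinarith
    calc lk * μ0 ≤ Real.exp (A * X) * (Real.exp (A * X) * (μk * T)) + 3 * |C₁| * X * (μk * T) := by
          nlinarith [mul_le_mul_of_nonneg_left h2 heA0]
      _ = (Real.exp (A * X) * Real.exp (A * X) + 3 * |C₁| * X) * (μk * T) := by ring
      _ ≤ Real.exp ((2 * A + 3 * |C₁|) * X) * (μk * T) :=
          mul_le_mul_of_nonneg_right (exp_add_linear_le hA hX) (mul_nonneg hμk hT)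
  · -- lower half
    calc μk * T ≤ μk * (eK * m0) := mul_le_mul_of_nonneg_left hcap0 hμk
      _ = eK * (μk * m0) := by ring
      _ ≤ Real.exp (A * X) * (μk * m0) := mul_le_mul_of_nonneg_right heK (mul_nonneg hμk hm0)
      _ ≤ Real.exp (A * X) * (eK * (mk * μ0)) := mul_le_mul_of_nonneg_left hrat2 heA0
      _ ≤ Real.exp (A * X) * (Real.exp (A * X) * (mk * μ0)) :=
          mul_le_mul_of_nonneg_left (mul_le_mul_of_nonneg_right heK (mul_nonneg hmk hμ0)) heA0
      _ ≤ Real.exp (A * X) * (Real.exp (A * X) * (lk * μ0)) :=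
          mul_le_mul_of_nonneg_left (mul_le_mul_of_nonneg_left (mul_le_mul_of_nonneg_right hritz hμ0) heA0) heA0
      _ = (Real.exp (A * X) * Real.exp (A * X)) * (lk * μ0) := by ring
      _ ≤ Real.exp ((2 * A + 3 * |C₁|) * X) * (lk * μ0) := mul_le_mul_of_nonneg_right hEE (mul_nonneg hlk hμ0)

end Summit.QuantumFields.YangMills.Theorems.StiffComplementSchur

end
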